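import Mathlib
import Summits.KontsevichZagierPeriods.Zeta5Search.FourthDigitSeries
import Summits.KontsevichZagierPeriods.Zeta5Search.FourthOrderTransport
import Summits.KontsevichZagierPeriods.Zeta5Search.SecondResidueLaw
import Summits.KontsevichZagierPeriods.Zeta5Search.SecondDigitWProof
import Summits.KontsevichZagierPeriods.Zeta5Search.FourthOrderReflectD
import HarnessLib

/-!
# ζ(5) search — (W4): the FOURTH digit of the `W`-row, classwise (PROVED)

Cell `pub-zeta5` (HONEST FRAMING: systematic search; no irrationality claim unless certified), gen-2 seat generation 15
(REPORT-gen2-g15 §4; typer g13's L5 work split, INBOX 2026-08-21T03:16Z).  We prove `SecondResidueLaw.FourthDigitW` (gen-2 g13,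
`SecondResidueLaw.lean` §1): for an admissible `b` (`InPolytope b`), a prime `p ≥ 5` with `b₀ + 2 < p²`, and a residue class `x (mod p)`
(`x < p`) containing a pole, with `E = E_x` the class exponent,
`W_x := Σ_{s ≡ x} pf₂(s) ≡ (−p)^{E+3} ĝ_x (ŵ_x − pφ_x ŵ₂,x + p²c_x ŵ₃,x − p³c₃,x ŵ₄,x)  (mod p^{E+7})`
(`fourthDigitW_holds`), one digit beyond `ThirdDigitWProof.thirdDigitW_holds` (typer g12), whose proof this file clones line by line.

## Proof

Termwise over the class.  At a pole `s = x + ℓp` of order `≥ 3`, Theorem B to fourth order (`FourthDigitSeries.leadingDigit₄`, `σ = 3`)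
gives `pf₂(s) ≡ (−p)^{E+3} ĝ_s (ρ₃ − pφ_sρ₄ + p²c_sρ₅ − p³c₃,sρ₆) (mod p^{E+7})`, and the fourth-order transport of the class units
(`FourthOrderTransport.fourthOrder_transport_bound`: `ĝ` mod `p⁴`, `φ` mod `p³`, `c` mod `p²`, `c₃` mod `p`) moves the units to the base:
`ĝ_s(ρ₃ − pφ_sρ₄ + p²c_sρ₅ − p³c₃,sρ₆) ≡ ĝ_x(ρ₃ − pφ_x(ℓρ₃ + ρ₄) + p²c_x(ℓ²ρ₃ + 2ℓρ₄ + ρ₅) − p³c₃,x(ℓ³ρ₃ + 3ℓ²ρ₄ + 3ℓρ₅ + ρ₆)) (mod p⁴)`;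
the brackets are exactly the `s`-contributions to `ŵ₂ = ŵ[ηΦ]`, `ŵ₃ = ŵ[η²Φ]`, `ŵ₄ = ŵ[η³Φ]` (`SecondResidueLaw.wHat4`).  Levels with pole
order `≤ 2` contribute `0` to both sides.  `SecondResidueLaw.cubicHat = (φ³ − 3φφ₂ + 2φ₃)/6` with `φ₃ = SecondResidueLaw.phi3Hat =
SecondOrder.phi3Expl` (`rfl`).  A `p`-adic valuation statement about the contiguity Casoratian; nothing here concerns irrationality.
-/

noncomputable section

open Finset PowerSeries

namespace Summit.KontsevichZagierPeriods.Zeta5Search.SecondOrder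

open Summit.KontsevichZagierPeriods.Zeta5Search.DualSeries (InBox)
open Summit.KontsevichZagierPeriods.Zeta5Search.WedgeDictionary (pfData)
open Summit.KontsevichZagierPeriods.Zeta5Search.CasoratianValuation (InPolytope)
open Summit.KontsevichZagierPeriods.Zeta5Search.ClusterValuation
open Summit.KontsevichZagierPeriods.Zeta5Search.PadicSeries
open Summit.KontsevichZagierPeriods.Zeta5Search.CellA (padicNorm_classRho_le_one pfData_eq_zero_of_order_le gHat_classCongr
  padicNorm_pow_eq padicNorm_mul_sub_mul_le padicNorm_p)
open Summit.KontsevichZagierPeriods.Zeta5Search.SecondResidueLaw (phi3Hat cubicHat wHat4 predW4 FourthDigitW)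

variable {p : ℕ} [hp : Fact p.Prime]

omit hp in
/-- `SecondResidueLaw.phi3Hat` is `SecondOrder.phi3Expl` (same definition). -/
theorem phi3Hat_eq_phi3Expl (b : ℕ → ℤ) (p x : ℕ) : phi3Hat b p x = phi3Expl b p x := rfl

omit hp in
/-- Linear-combination bookkeeping: `Σf₀ − A(Σf₁ − BΣf₂ + CΣf₃ − DΣf₄) = Σ(f₀ − A(f₁ − Bf₂ + Cf₃ − Df₄))`. -/
theorem sum_lincomb_four (s : Finset ℕ) (f₀ f₁ f₂ f₃ f₄ : ℕ → ℚ) (A B C D : ℚ) :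
    (∑ i ∈ s, f₀ i) - A * ((∑ i ∈ s, f₁ i) - B * (∑ i ∈ s, f₂ i) + C * (∑ i ∈ s, f₃ i) - D * (∑ i ∈ s, f₄ i)) =
      ∑ i ∈ s, (f₀ i - A * (f₁ i - B * f₂ i + C * f₃ i - D * f₄ i)) := by
  classical
  refine Finset.induction_on s (by simp) (fun a s ha ih => ?_)
  rw [sum_insert ha, sum_insert ha, sum_insert ha, sum_insert ha, sum_insert ha, sum_insert ha, ← ih]
  ring

/-- **(W4), PROVED: the fourth digit of the `W`-row.**  For admissible `b`, a prime `p ≥ 5` with `b₀ + 2 < p²`, and a residue class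
`x (mod p)` (`x < p`) containing a pole, with `E = E_x`:
`v_p( Σ_{s ≡ x} pf₂(s) − (−p)^{E+3} ĝ_x (ŵ_x − pφ_xŵ₂,x + p²c_xŵ₃,x − p³c₃,xŵ₄,x) ) ≥ E + 7` (when the difference is nonzero). -/
theorem fourthDigitW_holds : FourthDigitW := by
  intro b p x hb hprime hp5 hwin hx hpole hne
  haveI : Fact p.Prime := ⟨hprime⟩
  obtain ⟨hbox, -, -, hn⟩ := thmA_data b hb hwin
  have h0 : 0 ≤ b 0 := hbox.1
  have hp2 : p ≠ 2 := by omega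
  have hp0 : (p : ℚ) ≠ 0 := Nat.cast_ne_zero.2 hprime.ne_zero
  have hp' : (-(p : ℚ)) ≠ 0 := neg_ne_zero.2 hp0
  have hxmem : x ∈ classSet b p x := base_mem_classSet b hx hpole
  rw [predW4, cubicHat_eq] at hne ⊢
  set E := classExp b p x with hE
  set g := gHat b p x with hg
  set c₃ := (phiHat b p x ^ 3 - 3 * phiHat b p x * phi2Hat b p x + 2 * phi3Expl b p x) / 6 with hc₃
  set φ := phiHat b p x with hφ
  set c := curvHat b p x with hc
  -- `ŵ`, `ŵ₂`, `ŵ₃`, `ŵ₄` as sums over the whole class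
  have hw : wHat b p x = ∑ s ∈ classSet b p x, (if netExp b s ≤ -3 then classRho b p s 3 else 0) := by
    rw [wHat, classPoles, sum_filter]
    refine sum_congr rfl fun s _ => ?_
    by_cases h3 : netExp b s ≤ -3
    · rw [if_pos (by omega), if_pos h3]
    · rw [if_neg h3]; split_ifs <;> rfl
  have hw2 : wHat2 b p x = ∑ s ∈ classSet b p x,
      ((if netExp b s ≤ -3 then ((s / p : ℕ) : ℚ) * classRho b p s 3 else 0)
        + (if netExp b s ≤ -4 then classRho b p s 4 else 0)) := by
    rw [wHat2, classPoles, sum_filter]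
    refine sum_congr rfl fun s _ => ?_
    by_cases h3 : netExp b s ≤ -3
    · rw [if_pos (by omega)]
    · rw [if_neg h3, if_neg (show ¬ netExp b s ≤ -4 by omega)]; split_ifs <;> simp
  have hw3 : wHat3 b p x = ∑ s ∈ classSet b p x,
      ((if netExp b s ≤ -3 then ((s / p : ℕ) : ℚ) ^ 2 * classRho b p s 3 else 0)
        + (if netExp b s ≤ -4 then 2 * ((s / p : ℕ) : ℚ) * classRho b p s 4 else 0)
        + (if netExp b s ≤ -5 then classRho b p s 5 else 0)) := by
    rw [wHat3, classPoles, sum_filter]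
    refine sum_congr rfl fun s _ => ?_
    by_cases h3 : netExp b s ≤ -3
    · rw [if_pos (by omega)]
    · rw [if_neg h3, if_neg (show ¬ netExp b s ≤ -4 by omega), if_neg (show ¬ netExp b s ≤ -5 by omega)]
      split_ifs <;> simp
  have hw4 : wHat4 b p x = ∑ s ∈ classSet b p x,
      ((if netExp b s ≤ -3 then ((s / p : ℕ) : ℚ) ^ 3 * classRho b p s 3 else 0)
        + (if netExp b s ≤ -4 then 3 * ((s / p : ℕ) : ℚ) ^ 2 * classRho b p s 4 else 0)
        + (if netExp b s ≤ -5 then 3 * ((s / p : ℕ) : ℚ) * classRho b p s 5 else 0)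
        + (if netExp b s ≤ -6 then classRho b p s 6 else 0)) := by
    rw [wHat4, classPoles, sum_filter]
    refine sum_congr rfl fun s _ => ?_
    by_cases h3 : netExp b s ≤ -3
    · rw [if_pos (by omega)]
    · rw [if_neg h3, if_neg (show ¬ netExp b s ≤ -4 by omega), if_neg (show ¬ netExp b s ≤ -5 by omega),
        if_neg (show ¬ netExp b s ≤ -6 by omega)]
      split_ifs <;> simp
  -- the termwise form of the difference
  set T : ℕ → ℚ := fun s => pfData b 2 s - (-(p : ℚ)) ^ (E + 3) * g *
      ((if netExp b s ≤ -3 then classRho b p s 3 else 0)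
        - (p : ℚ) * φ * ((if netExp b s ≤ -3 then ((s / p : ℕ) : ℚ) * classRho b p s 3 else 0)
            + (if netExp b s ≤ -4 then classRho b p s 4 else 0))
        + (p : ℚ) ^ 2 * c * ((if netExp b s ≤ -3 then ((s / p : ℕ) : ℚ) ^ 2 * classRho b p s 3 else 0)
            + (if netExp b s ≤ -4 then 2 * ((s / p : ℕ) : ℚ) * classRho b p s 4 else 0)
            + (if netExp b s ≤ -5 then classRho b p s 5 else 0))
        - (p : ℚ) ^ 3 * c₃ * ((if netExp b s ≤ -3 then ((s / p : ℕ) : ℚ) ^ 3 * classRho b p s 3 else 0)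
            + (if netExp b s ≤ -4 then 3 * ((s / p : ℕ) : ℚ) ^ 2 * classRho b p s 4 else 0)
            + (if netExp b s ≤ -5 then 3 * ((s / p : ℕ) : ℚ) * classRho b p s 5 else 0)
            + (if netExp b s ≤ -6 then classRho b p s 6 else 0))) with hT
  have hsplit : (∑ s ∈ classSet b p x, pfData b 2 s)
      - (-(p : ℚ)) ^ (E + 3) * g * (wHat b p x - (p : ℚ) * φ * wHat2 b p x + (p : ℚ) ^ 2 * c * wHat3 b p x
          - (p : ℚ) ^ 3 * c₃ * wHat4 b p x) = ∑ s ∈ classSet b p x, T s := by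
    rw [hw, hw2, hw3, hw4, hT]
    exact sum_lincomb_four _ _ _ _ _ _ _ _ _ _
  -- common norms
  have hpow : padicNorm p ((-(p : ℚ)) ^ (E + 3)) = (p : ℚ) ^ (-(E + 3)) := by
    rw [padicNorm.eq_zpow_of_nonzero (zpow_ne_zero _ hp'), padicValRat.zpow, padicValRat.neg,
      padicValRat.self hprime.one_lt, mul_one]
  -- termwise bound `p^{-(E+7)}`
  have hterm : ∀ s ∈ classSet b p x, padicNorm p (T s) ≤ (p : ℚ) ^ (-(E + 7)) := by
    intro s hs
    have hsn : s ≤ (b 0).toNat := ((mem_classSet_iff b x s).1 hs).1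
    have hEs : classExp b p s = E := classExp_eq_of_mem hs
    by_cases h3 : netExp b s ≤ -3
    · -- a pole of order ≥ 3: fourth-order Theorem B, then move the units to the base
      have hTs : T s = pfData b 2 s - (-(p : ℚ)) ^ (E + 3) * g *
          (classRho b p s 3 - (p : ℚ) * φ * (((s / p : ℕ) : ℚ) * classRho b p s 3
              + (if netExp b s ≤ -4 then classRho b p s 4 else 0))
            + (p : ℚ) ^ 2 * c * (((s / p : ℕ) : ℚ) ^ 2 * classRho b p s 3
              + (if netExp b s ≤ -4 then 2 * ((s / p : ℕ) : ℚ) * classRho b p s 4 else 0)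
              + (if netExp b s ≤ -5 then classRho b p s 5 else 0))
            - (p : ℚ) ^ 3 * c₃ * (((s / p : ℕ) : ℚ) ^ 3 * classRho b p s 3
              + (if netExp b s ≤ -4 then 3 * ((s / p : ℕ) : ℚ) ^ 2 * classRho b p s 4 else 0)
              + (if netExp b s ≤ -5 then 3 * ((s / p : ℕ) : ℚ) * classRho b p s 5 else 0)
              + (if netExp b s ≤ -6 then classRho b p s 6 else 0))) := by
        simp only [hT, if_pos h3]
      have hρ4' : (if netExp b s ≤ -4 then 2 * ((s / p : ℕ) : ℚ) * classRho b p s 4 else 0)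
          = 2 * ((s / p : ℕ) : ℚ) * (if netExp b s ≤ -4 then classRho b p s 4 else 0) := by
        split_ifs <;> ring
      have hρ4'' : (if netExp b s ≤ -4 then 3 * ((s / p : ℕ) : ℚ) ^ 2 * classRho b p s 4 else 0)
          = 3 * ((s / p : ℕ) : ℚ) ^ 2 * (if netExp b s ≤ -4 then classRho b p s 4 else 0) := by
        split_ifs <;> ring
      have hρ5'' : (if netExp b s ≤ -5 then 3 * ((s / p : ℕ) : ℚ) * classRho b p s 5 else 0)
          = 3 * ((s / p : ℕ) : ℚ) * (if netExp b s ≤ -5 then classRho b p s 5 else 0) := by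
        split_ifs <;> ring
      rw [hρ4', hρ4'', hρ5''] at hTs
      set ρ3 := classRho b p s 3 with hρ3
      set ρ4 : ℚ := if netExp b s ≤ -4 then classRho b p s 4 else 0 with hρ4
      set ρ5 : ℚ := if netExp b s ≤ -5 then classRho b p s 5 else 0 with hρ5
      set ρ6 : ℚ := if netExp b s ≤ -6 then classRho b p s 6 else 0 with hρ6
      set gs := gHat b p s with hgs
      set φs := phiHat b p s with hφs
      set cs := curvHat b p s with hcs
      set c₃s := (phiHat b p s ^ 3 - 3 * phiHat b p s * phi2Hat b p s + 2 * phi3Expl b p s) / 6 with hc₃s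
      set ℓ : ℚ := ((s / p : ℕ) : ℚ) with hℓ
      -- Theorem B to fourth order at σ = 3
      have hB : padicNorm p (pfData b 2 s - (-(p : ℚ)) ^ (E + 3) * gs *
          (ρ3 - (p : ℚ) * φs * ρ4 + (p : ℚ) ^ 2 * cs * ρ5 - (p : ℚ) ^ 3 * c₃s * ρ6)) ≤ (p : ℚ) ^ (-(E + 7)) := by
        have h := leadingDigit₄ b hb hp5 hwin hsn (σ := 3) (by norm_num) (by push_cast; omega)
        have e4 : (if ((3 : ℕ) : ℤ) + 1 ≤ -netExp b s then classRho b p s (3 + 1) else 0) = ρ4 := by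
          rw [hρ4]
          by_cases h4 : netExp b s ≤ -4
          · rw [if_pos (by push_cast; omega), if_pos h4]
          · rw [if_neg (by push_cast; omega), if_neg h4]
        have e5 : (if ((3 : ℕ) : ℤ) + 2 ≤ -netExp b s then classRho b p s (3 + 2) else 0) = ρ5 := by
          rw [hρ5]
          by_cases h5 : netExp b s ≤ -5
          · rw [if_pos (by push_cast; omega), if_pos h5]
          · rw [if_neg (by push_cast; omega), if_neg h5]
        have e6 : (if ((3 : ℕ) : ℤ) + 3 ≤ -netExp b s then classRho b p s (3 + 3) else 0) = ρ6 := by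
          rw [hρ6]
          by_cases h6 : netExp b s ≤ -6
          · rw [if_pos (by push_cast; omega), if_pos h6]
          · rw [if_neg (by push_cast; omega), if_neg h6]
        rw [e4, e5, e6, hEs, show (3 : ℕ) - 1 = 2 from rfl, show ((3 : ℕ) : ℤ) + E = E + 3 by ring] at h
        rw [show -(E + 7) = -(E + 3 + 4) by ring]
        exact h
      -- norms of the units
      have hρ3n : padicNorm p ρ3 ≤ 1 := padicNorm_classRho_le_one b h0 hsn hn hp2 3
      have hρ4n : padicNorm p ρ4 ≤ 1 := by
        rw [hρ4]; split_ifs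
        · exact padicNorm_classRho_le_one b h0 hsn hn hp2 4
        · simp
      have hρ5n : padicNorm p ρ5 ≤ 1 := by
        rw [hρ5]; split_ifs
        · exact padicNorm_classRho_le_one b h0 hsn hn hp2 5
        · simp
      have hρ6n : padicNorm p ρ6 ≤ 1 := by
        rw [hρ6]; split_ifs
        · exact padicNorm_classRho_le_one b h0 hsn hn hp2 6
        · simp
      -- transport of the units to the base (mod p⁴)
      have hΔ : padicNorm p (gs * (ρ3 - (p : ℚ) * φs * ρ4 + (p : ℚ) ^ 2 * cs * ρ5 - (p : ℚ) ^ 3 * c₃s * ρ6)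
          - g * (ρ3 - (p : ℚ) * φ * (ℓ * ρ3 + ρ4) + (p : ℚ) ^ 2 * c * (ℓ ^ 2 * ρ3 + 2 * ℓ * ρ4 + ρ5)
              - (p : ℚ) ^ 3 * c₃ * (ℓ ^ 3 * ρ3 + 3 * ℓ ^ 2 * ρ4 + 3 * ℓ * ρ5 + ρ6))) ≤ (p : ℚ) ^ (-(4 : ℤ)) :=
        fourthOrder_transport_bound b hb hp5 hx hs hρ3n hρ4n hρ5n hρ6n
      -- the algebra: `T s − (Theorem-B term) = (−p)^{E+3} · Δ`
      have e : T s = (pfData b 2 s - (-(p : ℚ)) ^ (E + 3) * gs *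
            (ρ3 - (p : ℚ) * φs * ρ4 + (p : ℚ) ^ 2 * cs * ρ5 - (p : ℚ) ^ 3 * c₃s * ρ6))
          + (-(p : ℚ)) ^ (E + 3) * (gs * (ρ3 - (p : ℚ) * φs * ρ4 + (p : ℚ) ^ 2 * cs * ρ5 - (p : ℚ) ^ 3 * c₃s * ρ6)
              - g * (ρ3 - (p : ℚ) * φ * (ℓ * ρ3 + ρ4) + (p : ℚ) ^ 2 * c * (ℓ ^ 2 * ρ3 + 2 * ℓ * ρ4 + ρ5)
                  - (p : ℚ) ^ 3 * c₃ * (ℓ ^ 3 * ρ3 + 3 * ℓ ^ 2 * ρ4 + 3 * ℓ * ρ5 + ρ6))) := by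
        rw [hTs]; ring
      rw [e]
      refine (padicNorm.nonarchimedean (p := p)).trans (max_le hB ?_)
      rw [padicNorm.mul, hpow]
      calc (p : ℚ) ^ (-(E + 3)) * _ ≤ (p : ℚ) ^ (-(E + 3)) * (p : ℚ) ^ (-(4 : ℤ)) :=
            mul_le_mul_of_nonneg_left hΔ (zpow_p_nonneg _)
        _ = (p : ℚ) ^ (-(E + 7)) := by rw [← zpow_add₀ hp0]; ring_nf
    · -- no pole of order ≥ 3 at `s`: the term vanishes
      have hTs : T s = 0 := by
        simp only [hT, if_neg h3, if_neg (show ¬ netExp b s ≤ -4 by omega), if_neg (show ¬ netExp b s ≤ -5 by omega),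
          if_neg (show ¬ netExp b s ≤ -6 by omega)]
        rw [pfData_eq_zero_of_order_le b hb hsn (by norm_num) (by push_cast; omega)]
        ring
      rw [hTs, padicNorm.zero]; exact zpow_p_nonneg _
  apply val_ge_of_padicNorm_le hne
  rw [hsplit]
  exact padicNorm.sum_le' hterm (zpow_p_nonneg _)

end Summit.KontsevichZagierPeriods.Zeta5Search.SecondOrder

end
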